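import Mathlib
import Summits.ResolutionOfSingularities.ResolutionOfSingularities.Theorems.WeightedInvariantLocalWeightedDropNCPolyBridgeDispatch
import Summits.ResolutionOfSingularities.ResolutionOfSingularities.Theorems.WeightedInvariantLocalWeightedDropNCGameDecoratedWins
import Summits.ResolutionOfSingularities.ResolutionOfSingularities.Theorems.WeightedInvariantLocalWeightedDropPolyDescentRegimeRank

/-!
# `WeightedInvariant.LocalWeightedDrop`, TOT2-LINE piece S-E2′ (the count-game bridge), part 4: THE REGIME «e = 2» IS LEFT IN FINITELY MANY MOVES —
# the polyhedron rank of ρ-T `stub_polyNoChain` as a decorated winning region of the NC count game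

Crux item stmt-ResolutionOfSingularities-8899 `LocalWeightedDrop` (route `ResolutionOfSingularities/WeightedInvariant`), ENGINE skeleton v32
(ddb48572591139d5), registered stub `stub_spaceNCRankDrop`; TOT2-LINE v1.1 §(E) piece **S-E2′** (`L/res-L1-w43-lead-1/g4/TOT2-LINE.md`):
«an infinite play of the strategy with `e(f̃) = 2` throughout and no conflict states would be an infinite Σ**_d-chain of well-prepared positive
labels — contradicting ρ-T» — here in its positive, kernel form: a DECORATED WINNING REGION towards the exits.
[OURS · L1 W4.3 · chain w43 · lead-1 gen 4; bricks: lead-1's ρ-T `PolyDescent.stub_polyNoChain` (p517324) with ρ-P `stub_polyPrep` (res-type-061 +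
stub-2, p519588) and `stub_polyMinimality`; the dispatch of part 3; the decorated regions `TameFourTupleDrop.DWinsTo` (p528575).  MODEL:
Cossart–Jannsen–Saito LNM 2270 Thm 5.40 / §§10–13 read WITHOUT the isolation hypothesis (the polyhedron game handles non-isolated points); Perlega
arXiv:2011.14443 §7.  Nothing here is a statement of any manuscript; the games are the programme's own.  AI-produced, gate-checked, weaker than
expert review.]

* (…PolyDescentRegimeRank: `PolyDescent.InPoly` — the regime; `PolyRel`, `wellFounded_polyRel`, `polyRank`, `polyRank_lt` — ρ-T as a rank;)
* `Conflict d A N` — graph-curve step with `u₂ ∈ N`;  `Exit d (b, A, N)` — unit × monomial, or represents a label outside the regime, or a conflict;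
* **`dWinsTo_exit`** — S-E2′: from every state representing a regime label the mover forces an exit (`DWinsTo Prod.fst (Exit d)`), by
  `DWinsTo.of_measure` with the polyhedron rank;  `winsOrd_exit` — the positional corollary (`WinsOrd`);
* reading the exits: `germIsNC_of_represents_of_not_nonempty` (empty Newton set ⇒ the position is a normal crossing; with
  `PolyDescent.exit_cases` the other exits are order drops / directrix growth — the hand-over to the other regime pieces).
-/

set_option linter.dupNamespace false -- mandated namespace of this single-conjunct summit

noncomputable section

namespace Summit.ResolutionOfSingularities.ResolutionOfSingularities.Theorems

namespace NCPoly

open MvPowerSeries Literature.AlgebraicGeometry.Resolution TameFourTupleDrop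

variable {k : Type} [Field k]

/-! ## Conflicts and exits -/

/-- A CONFLICT STATE: the step of Σ**_d at `A` is the graph-curve step while `u₂ = 0` is a boundary plane (the graph curve is tangent to, or meets
a second boundary plane at, the point: not B-permissible — the states (K1)/(K2) of the TOT2-LINE, where the strategy deviates to the point move). -/
def Conflict (d : ℕ) (A : Fin d → MvPowerSeries (Fin 2) k) (N : Finset (Fin 2)) : Prop :=
  ¬ PolyDescent.IsPermissibleOneT d A ∧ ¬ PolyDescent.IsPermissibleTwoT d A ∧ PolyDescent.HasGraphCurveT d A ∧ (1 : Fin 2) ∈ N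

/-- THE EXITS of the regime for a decorated state `(b, A, N)`: the germ is unit × monomial (the mover has won), or it represents a label OUTSIDE
the regime (order drop, `e ≤ 1`, or empty Newton set — handed to the other regime pieces of the line), or it is a conflict state (handed to S-CRV). -/
def Exit (d : ℕ) (σ : MvPowerSeries (Fin 3) k × (Fin d → MvPowerSeries (Fin 2) k) × Finset (Fin 2)) : Prop :=
  IsStdNC σ.1 ∨ (Represents σ.1 d σ.2.1 σ.2.2 ∧ (¬ PolyDescent.InPoly d σ.2.1 ∨ Conflict d σ.2.1 σ.2.2))

/-! ## S-E2′: the regime is left in finitely many moves -/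

/-- **S-E2′ OF THE TOT2-LINE (the count-game bridge, assembled).**  From every position `b` of the NC count game that represents a label of the
regime «e = 2» — a well-prepared positive label `A` with non-empty Newton set, with coordinate boundary `N` — the mover FORCES AN EXIT in the sense of
the decorated winning regions `TameFourTupleDrop.DWinsTo` (p528575): following the polyhedron strategy Σ**_d read in representing coordinates
(`succMove_of_represents`), every play reaches, after finitely many moves, a position that is unit × monomial, or represents a label outside the
regime, or is a conflict state.  Termination is the polyhedron rank (`polyRank`, from ρ-T `stub_polyNoChain`) via `DWinsTo.of_measure`; a conflict
state is an exit at once.  (Every field `k`, every `d ≥ 1`; no characteristic hypothesis.) -/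
theorem dWinsTo_exit {d : ℕ} (hd : 0 < d) (σ : MvPowerSeries (Fin 3) k × (Fin d → MvPowerSeries (Fin 2) k) × Finset (Fin 2))
    (hrep : Represents σ.1 d σ.2.1 σ.2.2) (hin : PolyDescent.InPoly d σ.2.1) :
    DWinsTo (m := 2) (Prod.fst : MvPowerSeries (Fin 3) k × (Fin d → MvPowerSeries (Fin 2) k) × Finset (Fin 2) → MvPowerSeries (Fin 3) k)
      (Exit d) σ := by
  classical
  by_cases hconf : Conflict d σ.2.1 σ.2.2
  · exact DWinsTo.of_target (Or.inr ⟨hrep, Or.inr hconf⟩)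
  refine DWinsTo.of_measure {τ | Represents τ.1 d τ.2.1 τ.2.2 ∧ PolyDescent.InPoly d τ.2.1 ∧ ¬ Conflict d τ.2.1 τ.2.2}
    (fun τ => PolyDescent.polyRank hd τ.2.1) ?_ ⟨hrep, hin, hconf⟩
  rintro ⟨b, A, N⟩ ⟨hrepτ, hP, hnc⟩ -
  obtain ⟨Φ, w, hmv, hcl⟩ := succMove_of_represents hd hP.2.1 hrepτ (fun h1 h2 h3 h1N => hnc ⟨h1, h2, h3, h1N⟩)
  refine ⟨Φ, w, hmv, hcl.mono fun b' hb' => ?_⟩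
  rcases hb' with hstd | ⟨A', hA', N', hrep'⟩
  · exact ⟨(b', A, N), rfl, Or.inl (Or.inl hstd)⟩
  · by_cases hP' : PolyDescent.InPoly d A'
    · by_cases hc' : Conflict d A' N'
      · exact ⟨(b', A', N'), rfl, Or.inl (Or.inr ⟨hrep', Or.inr hc'⟩)⟩
      · exact ⟨(b', A', N'), rfl, Or.inr ⟨⟨hrep', hP', hc'⟩, PolyDescent.polyRank_lt hd ⟨hA', hP, hP'⟩⟩⟩
    · exact ⟨(b', A', N'), rfl, Or.inl (Or.inr ⟨hrep', Or.inl hP'⟩)⟩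

/-- **POSITIONAL COROLLARY.**  The germ of a represented regime state is transfinitely winnable towards «unit × monomial, or the germ of an exit
state» in the sense of `WinsOrd` (…NCGameRank): `winsOrd_of_dWinsTo`. -/
theorem winsOrd_exit {d : ℕ} (hd : 0 < d) {b : MvPowerSeries (Fin 3) k} {A : Fin d → MvPowerSeries (Fin 2) k} {N : Finset (Fin 2)}
    (hrep : Represents b d A N) (hin : PolyDescent.InPoly d A) :
    ∃ α, WinsOrd (m := 2) (fun g => ∃ τ : MvPowerSeries (Fin 3) k × (Fin d → MvPowerSeries (Fin 2) k) × Finset (Fin 2),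
      τ.1 = g ∧ Exit d τ) α b := by
  have h := dWinsTo_exit hd (b, A, N) hrep hin
  exact winsOrd_of_dWinsTo (h.mono fun τ hτ => ⟨τ, rfl, hτ⟩)

/-! ## Reading the exits -/

/-- The monic germ of the zero label is `y^d`. -/
theorem monicGerm_zero (d : ℕ) : monicGerm d (fun _ => (0 : MvPowerSeries (Fin 2) k)) = X (Fin.last 2) ^ d := by
  unfold monicGerm
  simp

/-- **EMPTY NEWTON SET ⇒ NORMAL CROSSING.**  A position representing a label with empty Newton set (the zero label, germ `y^d · ∏ u_l`) is a normal
crossing in the representing coordinates (`GermIsNC`): the mover has won there. -/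
theorem germIsNC_of_represents_of_not_nonempty {b : MvPowerSeries (Fin 3) k} {d : ℕ} {A : Fin d → MvPowerSeries (Fin 2) k} {N : Finset (Fin 2)}
    (hrep : Represents b d A N) (hA : ¬ (WildMonic.newtonSet A).Nonempty) : GermIsNC b := by
  classical
  obtain ⟨Θ, U, hΘ0, hdet, hU, hb⟩ := hrep
  rw [PolyDescent.eq_zero_of_newtonSet_not_nonempty hA, monicGerm_zero, bdry_eq] at hb
  refine ⟨Θ, U, ![if (0 : Fin 2) ∈ N then 1 else 0, if (1 : Fin 2) ∈ N then 1 else 0, d], hΘ0, hdet, hU, ?_⟩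
  rw [hb, Fin.prod_univ_three]
  simp only [Matrix.cons_val_zero, Matrix.cons_val_one, Matrix.cons_val]
  rw [show (Fin.last 2 : Fin 3) = 2 from rfl]
  split_ifs <;> simp <;> ring


end NCPoly

end Summit.ResolutionOfSingularities.ResolutionOfSingularities.Theorems

end
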